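import Literature.AlgebraicGeometry.GroupSchemes.CartierDualBlockDuality     -- ★ (C1) `cartierDual`, `cartierDualMap`, `isMonHom_of_comp_mono`, the block-duality currency
import HarnessLib

/-!
# Two isotropic subgroups of a self-dual finite group scheme with the SAME part on one block of an adjoint pair of idempotents are EQUAL
# ([Mumford AV] §23 Thm. 2 (p. 231) «maximal isotropic»; [Tate 1997] §(3.8); [Oda 1969] Cor. 1.3)

Topic `Literature/AlgebraicGeometry/GroupSchemes`; namespace `Literature.AlgebraicGeometry.GroupSchemes.AffineGroupScheme` (continues ★ `CartierDualBlockDuality`,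
★ `CartierDualLagrangian`, ★ `CartierDualAnnihilatorOfDuality`: the ABSTRACT-DUALITY currency `e : G ≅ G^D`, `j^D = cartierDualMap j`).  THEOREMS ONLY (no definition,
no named fact, no instance, no notation, no `sorry`).  Cell `hodgecm-mathlib` (D-0151), P6 «MOD programme» (crux hLiu418 = stmt-HodgeConjecture-24832, `--supports`,
count-neutral), half-A line L2, LA2-plan (g0) ρ-ROAD v2∕v2.1 organ **(ρ2′) = (ISO-q) ∘ (W-λ) ∘ (BLK)**, piece **(BLK)** — the purely formal bookkeeping step: once the
kernels `Kᵢ = Ker q̄ᵢ ⊂ G = A[𝔭_w𝔭_{c•w}]` are known to be ISOTROPIC (★ (ISO-q) `WeilUnitKernelIsotropicOfDescent`, via (W-λ)) — indeed LAGRANGIAN by rank (★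
`CartierDualLagrangian`, the consumer's `hrk`) —, stable under the CRT block idempotent `ε_{c•w}` (★ `TorsionLayerBlockIdempotents`), and to have the SAME `c•w`-part, they are equal.  HONEST LABEL: HC_CM is proved only modulo the 2 remaining named inputs (hLiu418 24832, h413 24833) until rung 0 closes; this file is
generic and discharges none of them.

THE MATHEMATICS ([MumfordAV1970] §23 p. 231: a maximal isotropic subgroup is determined by its position against a complementary pair of blocks; [Tate1997FiniteFlatGroupSchemes]
§(3.8): `Hom(T, G^D)` = characters of `G_T`, duality exact and contravariant).  Let `G` be a finite commutative group scheme over a field `k` with a duality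
`e : G → G^D`, and `ε_W, ε_V : G → G` with `ε_W · ε_V = 1` (POINTWISE product = identity: every point is the product of its two parts), `ε_V` an idempotent
homomorphism, ADJOINT to `ε_W` under `e`: `ε_W ≫ e = e ≫ ε_V^D` (for `G = A[𝔭_w𝔭_{c•w}]`, `e = e_{pλ}`: Rosati `ι(a)† = ι(ā)` swaps the CRT idempotents).  Let
`κᵢ : Kᵢ ↪ G` (`i = 1, 2`) be monomorphic homomorphisms with: `K₁` ISOTROPIC (`t ∈ K₁ ⇒ e(t)|_{K₁} = 1`), `K₂` COISOTROPIC (`e(t)|_{K₂} = 1 ⇒ t ∈ K₂`; both hold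
for Lagrangians), `K₁`, `K₂` stable under `ε_V` (on `T`-points; NO `ε_W`-stability is needed), and EQUAL `V`-PARTS: for `t` with `ε_V t = t`, `t ∈ K₁ ↔ t ∈ K₂`.  THEN
`K₁ ≤ K₂` on `T`-points: for `t ∈ K₁` write `t = (ε_W t)·(ε_V t)`; `ε_V t ∈ K₁` has `ε_V(ε_V t) = ε_V t`, so `ε_V t ∈ K₂`; and `ε_W t ∈ K₂` by coisotropy:
`e(ε_W t)|_{K₂} = (e(t) ∘ ε_V)|_{K₂} = e(t) ∘ (κ₂ ≫ ε_V) = e(t) ∘ (φ ≫ κ₁) = (e(t)|_{K₁}) ∘ φ = 1`, where `φ : K₂ → K₁` lifts `κ₂ ≫ ε_V` (the `V`-part of `K₂`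
lies in `K₁`: equal `V`-parts, read at the universal point `T = K₂`) and `e(t)|_{K₁} = 1` by isotropy.  With the hypotheses on both sides, `K₁ = K₂`.

* **`exists_comp_eq_of_isotropic_of_coisotropic_of_blocks`** — `K₁ ≤ K₂` (one-sided hypotheses as above);
* **`exists_comp_eq_iff_of_lagrangian_of_blocks`** — THE HEAD: `t ∈ K₁ ↔ t ∈ K₂` for all `T`-points `t` of `G` (both `Kᵢ` Lagrangian in the points form
  `(∃ s, s ≫ κᵢ = t) ↔ (t ≫ e.hom) ≫ κᵢ^D = 1` — ★ `CartierDualLagrangian` + ★ `CartierDualAnnihilatorOfDuality` §2 deliver it from «isotropic + half rank» —,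
  both stable under `ε_V`, equal `V`-parts) — the input «`∀ t, t ≫ q̄₁ = 1 ↔ t ≫ q̄₂ = 1`» of ★ `RoofTargetUnique` ∕ ★ `AbelianSchemeHomDescentKernelEq` once
  `Kᵢ = Ker q̄ᵢ` are realised inside `G`.

## References
* [MumfordAV1970] D. Mumford, *Abelian Varieties* (1970), §23 Thm. 2 (p. 231), §20 (I) (p. 189).
* [Tate1997FiniteFlatGroupSchemes] J. Tate, *Finite flat group schemes* (1997), §(3.8) pp. 145–146.
* [Oda1969] T. Oda, *The first de Rham cohomology group and Dieudonné modules*, Ann. Sci. ÉNS (4) 2 (1969), Cor. 1.3.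
-/

set_option autoImplicit false

-- Mathlib's `Over`/`Scheme` APIs are stated across semireducible wrappers (as in the ★ `GroupSchemes/*` files).
set_option backward.isDefEq.respectTransparency false

universe u

open CategoryTheory CategoryTheory.Limits AlgebraicGeometry MonoidalCategory CartesianMonoidalCategory

noncomputable section

namespace Literature.AlgebraicGeometry.GroupSchemes

namespace AffineGroupScheme

open scoped MonObj

open Literature.AlgebraicGeometry.Motives GroupSchemeKernel

section IsotropicBlocks

variable {k : Type u} [Field k]
  (G : SchemeOver k) [GrpObj G] [IsCommMonObj G] [IsAffine G.left]
  (e : G ≅ cartierDual G)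
  (εW εV : G ⟶ G) [IsMonHom εV]
  (K₁ : SchemeOver k) [GrpObj K₁] [IsCommMonObj K₁] [IsAffine K₁.left] [Module.Free k (Alg K₁)] [Module.Finite k (Alg K₁)]
  (κ₁ : K₁ ⟶ G) [IsMonHom κ₁] [Mono κ₁]
  (K₂ : SchemeOver k) [GrpObj K₂] [IsCommMonObj K₂] [IsAffine K₂.left] [Module.Free k (Alg K₂)] [Module.Finite k (Alg K₂)]
  (κ₂ : K₂ ⟶ G) [IsMonHom κ₂] [Mono κ₂]

omit [Mono κ₂] in
/-- **AN ISOTROPIC SUBGROUP WITH THE SAME `V`-PART AS A COISOTROPIC ONE LIES INSIDE IT** (pointwise decomposition `t = ε_W t · ε_V t`; the `V`-part moves by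
hypothesis; the `W`-part pairs trivially with `K₂` because, by the adjointness `ε_W ≫ e = e ≫ ε_V^D`, its character is `e(t)` pulled back along `κ₂ ≫ ε_V`, which factors
through `K₁` — read at the universal point `T = K₂` — where `e(t)` vanishes).  One-sided hypotheses: `K₁` isotropic and `ε_V`-stable, `K₂` coisotropic and
`ε_V`-stable (no `ε_W`-stability is needed). [cite: MumfordAV1970, §23 Thm. 2 (p. 231)] [cite: Tate1997FiniteFlatGroupSchemes, §(3.8) pp. 145–146] -/
theorem exists_comp_eq_of_isotropic_of_coisotropic_of_blocks
    (hsum : εW * εV = 𝟙 G) (hVV : εV ≫ εV = εV) (hadj : εW ≫ e.hom = e.hom ≫ cartierDualMap εV)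
    (hiso₁ : ∀ ⦃T : SchemeOver k⦄ (t : T ⟶ G), (∃ s : T ⟶ K₁, s ≫ κ₁ = t) → (t ≫ e.hom) ≫ cartierDualMap κ₁ = 1)
    (hcoiso₂ : ∀ ⦃T : SchemeOver k⦄ (t : T ⟶ G), (t ≫ e.hom) ≫ cartierDualMap κ₂ = 1 → ∃ s : T ⟶ K₂, s ≫ κ₂ = t)
    (hV₁ : ∀ ⦃T : SchemeOver k⦄ (t : T ⟶ G), (∃ s : T ⟶ K₁, s ≫ κ₁ = t) → ∃ s : T ⟶ K₁, s ≫ κ₁ = t ≫ εV)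
    (hV₂ : ∀ ⦃T : SchemeOver k⦄ (t : T ⟶ G), (∃ s : T ⟶ K₂, s ≫ κ₂ = t) → ∃ s : T ⟶ K₂, s ≫ κ₂ = t ≫ εV)
    (hV : ∀ ⦃T : SchemeOver k⦄ (t : T ⟶ G), t ≫ εV = t → ((∃ s : T ⟶ K₁, s ≫ κ₁ = t) ↔ ∃ s : T ⟶ K₂, s ≫ κ₂ = t))
    ⦃T : SchemeOver k⦄ (t : T ⟶ G) (ht : ∃ s : T ⟶ K₁, s ≫ κ₁ = t) : ∃ s : T ⟶ K₂, s ≫ κ₂ = t := by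
  -- the `V`-part of `K₂` lies in `K₁`: a lift `φ : K₂ → K₁` of `κ₂ ≫ ε_V` (universal point `T = K₂`)
  have hκ₂V : ∃ s : K₂ ⟶ K₂, s ≫ κ₂ = κ₂ ≫ εV := hV₂ κ₂ ⟨𝟙 K₂, Category.id_comp _⟩
  have hfix : (κ₂ ≫ εV) ≫ εV = κ₂ ≫ εV := by rw [Category.assoc, hVV]
  obtain ⟨φ, hφ⟩ := (hV (κ₂ ≫ εV) hfix).mpr hκ₂V
  haveI : IsMonHom (φ ≫ κ₁) := by rw [hφ]; infer_instance
  haveI : IsMonHom φ := isMonHom_of_comp_mono φ κ₁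
  -- the `W`-part of `t` pairs trivially with `K₂`, hence lies in `K₂`
  have h1 : (t ≫ e.hom) ≫ cartierDualMap κ₁ = 1 := hiso₁ t ht
  have hWchar : ((t ≫ εW) ≫ e.hom) ≫ cartierDualMap κ₂ = 1 := by
    rw [Category.assoc t εW e.hom, hadj, ← Category.assoc t e.hom (cartierDualMap εV), Category.assoc (t ≫ e.hom),
      ← cartierDualMap_comp κ₂ εV, cartierDualMap_congr hφ.symm, cartierDualMap_comp φ κ₁, ← Category.assoc, h1, MonObj.one_comp]
  obtain ⟨sW, hsW⟩ := hcoiso₂ (t ≫ εW) hWchar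
  -- the `V`-part of `t` lies in `K₁`, is fixed by `ε_V`, hence lies in `K₂`
  obtain ⟨s₁, hs₁⟩ := hV₁ t ht
  have hfix' : (t ≫ εV) ≫ εV = t ≫ εV := by rw [Category.assoc, hVV]
  obtain ⟨sV, hsV⟩ := (hV (t ≫ εV) hfix').mp ⟨s₁, hs₁⟩
  -- `t = ε_W t · ε_V t`
  refine ⟨sW * sV, ?_⟩
  rw [MonObj.mul_comp, hsW, hsV, ← MonObj.comp_mul, hsum, Category.comp_id]

/-- **HEAD (BLK) — TWO LAGRANGIAN SUBGROUPS, STABLE UNDER AN ADJOINT PAIR OF COMPLEMENTARY IDEMPOTENTS, WITH THE SAME `V`-PART, ARE EQUAL** (on `T`-points: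
`t ∈ K₁ ↔ t ∈ K₂`).  Lagrangian is taken in the points form `(∃ s, s ≫ κᵢ = t) ↔ (t ≫ e.hom) ≫ κᵢ^D = 1` («`t ∈ Kᵢ` iff the character `e(t)` is trivial on `Kᵢ`»,
`Kᵢ^⊥ = Kᵢ` — ★ `CartierDualLagrangian` with ★ `CartierDualAnnihilatorOfDuality` §2 produce it from isotropy + the rank clause `rk G = (rk Kᵢ)²`); `ε_V`-stability on
`T`-points; `ε_W · ε_V = 1`, `ε_V` idempotent, `ε_W ≫ e = e ≫ ε_V^D`.  For the consumer (ρ2′): `G = A[𝔭_w𝔭_{c•w}]`, `e = e_{pλ}` cut by the CRT idempotents ((W-λ)),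
`Kᵢ = Ker q̄ᵢ` isotropic by ★ (ISO-q), equal `c•w`-parts by hypothesis ⇒ equal kernels ⇒ ★ `RoofTargetUnique`.
[cite: MumfordAV1970, §23 Thm. 2 (p. 231)] [cite: Tate1997FiniteFlatGroupSchemes, §(3.8) pp. 145–146] [cite: Oda1969, Cor. 1.3] -/
theorem exists_comp_eq_iff_of_lagrangian_of_blocks
    (hsum : εW * εV = 𝟙 G) (hVV : εV ≫ εV = εV) (hadj : εW ≫ e.hom = e.hom ≫ cartierDualMap εV)
    (hlag₁ : ∀ ⦃T : SchemeOver k⦄ (t : T ⟶ G), (∃ s : T ⟶ K₁, s ≫ κ₁ = t) ↔ (t ≫ e.hom) ≫ cartierDualMap κ₁ = 1)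
    (hlag₂ : ∀ ⦃T : SchemeOver k⦄ (t : T ⟶ G), (∃ s : T ⟶ K₂, s ≫ κ₂ = t) ↔ (t ≫ e.hom) ≫ cartierDualMap κ₂ = 1)
    (hV₁ : ∀ ⦃T : SchemeOver k⦄ (t : T ⟶ G), (∃ s : T ⟶ K₁, s ≫ κ₁ = t) → ∃ s : T ⟶ K₁, s ≫ κ₁ = t ≫ εV)
    (hV₂ : ∀ ⦃T : SchemeOver k⦄ (t : T ⟶ G), (∃ s : T ⟶ K₂, s ≫ κ₂ = t) → ∃ s : T ⟶ K₂, s ≫ κ₂ = t ≫ εV)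
    (hV : ∀ ⦃T : SchemeOver k⦄ (t : T ⟶ G), t ≫ εV = t → ((∃ s : T ⟶ K₁, s ≫ κ₁ = t) ↔ ∃ s : T ⟶ K₂, s ≫ κ₂ = t))
    ⦃T : SchemeOver k⦄ (t : T ⟶ G) : (∃ s : T ⟶ K₁, s ≫ κ₁ = t) ↔ ∃ s : T ⟶ K₂, s ≫ κ₂ = t :=
  ⟨exists_comp_eq_of_isotropic_of_coisotropic_of_blocks G e εW εV K₁ κ₁ K₂ κ₂ hsum hVV hadj (fun _ t ht => (hlag₁ t).mp ht)
      (fun _ t ht => (hlag₂ t).mpr ht) hV₁ hV₂ hV t,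
    exists_comp_eq_of_isotropic_of_coisotropic_of_blocks G e εW εV K₂ κ₂ K₁ κ₁ hsum hVV hadj (fun _ t ht => (hlag₂ t).mp ht)
      (fun _ t ht => (hlag₁ t).mpr ht) hV₂ hV₁ (fun _ t hfix => (hV t hfix).symm) t⟩

end IsotropicBlocks

end AffineGroupScheme

end Literature.AlgebraicGeometry.GroupSchemes

end
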